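import Summits.CriticalPhenomena.SAWScalingLimit.Theorems.SAWDevelopingMapObservableToSLETypeLadderCarvedReductionSqueezeInner
import HarnessLib

/-!
# The two-piece deep set at a fixed mesh: scales, floor rows, zones (piece (G2-fam-d) of stub T2b″)

Crux `SAWDevelopingMap.ObservableToSLE` (stmt-CriticalPhenomena-10472), line `six-class-type-ladder`,
stub T2b″ `stub_carvedReduction_squeezeSolid`.  Landing target:
`Summits/CriticalPhenomena/SAWScalingLimit/Theorems/SAWDevelopingMapObservableToSLETypeLadderCarvedReductionSqueezeFamilyCore.lean`
(`--supports stmt-CriticalPhenomena-10472`).  Sequel of `…SqueezeInner`.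

Bookkeeping for the two-piece admissible family (next file `…SqueezeFamily`): at mesh `δ` the deep
set of a domain `Ω` with gate boxes `B_i = [Re(p i) ± ρc] × [Im(p i) - ρc', Im(p i)] ⊆ Ωᶜ` and
free thresholds `m i δ` is

`S δ = {u | δ c_u ∈ Ω ∧ (∀ i, ¬ Zone_i u) ∧ closedBall (δ c_u) (25δ) ⊆ Ω ∪ X δ}`,
`Zone_i u ↔ |Re(δ c_u) - Re(p i)| < ρc + 10δ ∧ mlo i δ ≤ row u < m i δ`,
`X δ = ⋃ i, {x | |Re x - Re(p i)| ≤ ρc ∧ Im(p i) - 30δ ≤ Im x ≤ Im(p i)}` (exempt slabs),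

with the FLOOR DEPTH ROW `mlo i δ = ⌈(Im(p i) - ρc' + 8δ)/(δ√3/2) - 1/3⌉` (`twoPiece_mlo_spec`: rows
`≥ mlo` lie at height `≥ Im(p i) - ρc' + 8δ`, heights `≥ Im(p i) - ρc'/2` have row `≥ mlo`).  This
file proves that these choices satisfy the hypotheses of the escape / inner-domain lemmas
(`twoPiece_scales`), that CLEARLY DEEP vertices (`δ c_u ∈ Ω`, disc in `Ω ∪ X δ`, row `≥ m i δ`
in the slightly larger box `|ΔRe| < ρc + 10δ`, `|ΔIm| < ρc'`) are deep once the thresholds are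
below `Im(p i) + ρc'` (`twoPiece_deep_of_clearlyDeep`), and the ZONE EXCLUSION of interior vertices
(`twoPiece_not_zone_of_closedBall_subset`: a vertex whose closed `t`-disc lies in `Ω` is in no zone
as soon as the thresholds are below `Im(p i) + ε` and `10δ + ε ≤ t` — clamp the centre into the
box).  Registered: `stub_carvedReduction_twoPieceFamilyCore` (= the zone exclusion).
-/

noncomputable section

open scoped Topology
open Filter Set Metric
open Literature.Probability.LatticeModels (HexVertex hexGraph hexCenter Site)
open Literature.Probability.RandomPlanarGeometry
open Literature.Probability.RandomPlanarGeometry.SAW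
open Literature.Probability.Percolation (PathIn hexCenter_im hexCenter_re)

namespace Summit.CriticalPhenomena.SAWScalingLimit.Theorems.ObservableToSLE.TypeLadder

open Summit.CriticalPhenomena.SAWScalingLimit.Theorems.ObservableToSLE.FloorRatio

/-! ### The floor depth row -/

/-- **The floor depth row.**  For `0 < δ`, `20δ ≤ ρc'`, the integer
`mlo = ⌈(h - ρc' + 8δ)/(δ√3/2) - 1/3⌉` satisfies: every vertex of row `≥ mlo` has height
`≥ h - ρc' + 8δ`, and every vertex of height `≥ h - ρc'/2` has row `≥ mlo`. -/
theorem twoPiece_mlo_spec {δ ρc' : ℝ} (hδ : 0 < δ) (hρc' : 20 * δ ≤ ρc') (h : ℝ) :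
    (∀ u : HexVertex, ⌈(h - ρc' + 8 * δ) / (δ * (Real.sqrt 3 / 2)) - 1 / 3⌉ ≤ u.1 1 →
        h - ρc' + 8 * δ ≤ ((δ : ℂ) * hexCenter u).im) ∧
      (∀ u : HexVertex, h - ρc' / 2 ≤ ((δ : ℂ) * hexCenter u).im →
        ⌈(h - ρc' + 8 * δ) / (δ * (Real.sqrt 3 / 2)) - 1 / 3⌉ ≤ u.1 1) := by
  set c : ℝ := δ * (Real.sqrt 3 / 2) with hc
  have hc0 : 0 < c := by positivity
  have hcδ : c ≤ δ := by
    have hs : Real.sqrt 3 / 2 ≤ 1 := by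
      rw [div_le_one (by norm_num : (0:ℝ) < 2)]
      have := Real.sqrt_le_sqrt (show (3:ℝ) ≤ 4 by norm_num)
      rwa [show (4:ℝ) = 2 ^ 2 by norm_num, Real.sqrt_sq (by norm_num : (0:ℝ) ≤ 2)] at this
    rw [hc]; nlinarith
  set mlo : ℤ := ⌈(h - ρc' + 8 * δ) / c - 1 / 3⌉ with hmlo
  have hmlo1 : (h - ρc' + 8 * δ) / c - 1 / 3 ≤ (mlo : ℝ) := Int.le_ceil _
  have hmlo2 : (mlo : ℝ) < (h - ρc' + 8 * δ) / c - 1 / 3 + 1 := Int.ceil_lt_add_one _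
  constructor
  · intro u hu
    have h1 : ((mlo : ℝ) + 1 / 3) * c ≤ ((δ : ℂ) * hexCenter u).im := (row_le_iff_im hδ mlo u).1 hu
    have h2 : (h - ρc' + 8 * δ) / c * c = h - ρc' + 8 * δ := div_mul_cancel₀ _ hc0.ne'
    nlinarith
  · intro u hu
    by_contra hlt
    push Not at hlt
    -- row `≤ mlo - 1`: height `≤ (mlo - 1 + 2/3) c = (mlo - 1/3) c`
    have h1 : ((δ : ℂ) * hexCenter u).im < ((mlo : ℝ) + 1 / 3) * c := by
      have := im_lt_of_row_lt hδ hlt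
      rwa [hc]
    have h2 : (h - ρc' + 8 * δ) / c * c = h - ρc' + 8 * δ := div_mul_cancel₀ _ hc0.ne'
    have h3 : ((mlo : ℝ) + 1 / 3) * c < ((h - ρc' + 8 * δ) / c + 1 + 1 / 3) * c := by
      exact mul_lt_mul_of_pos_right (by linarith) hc0
    have h4 : ((h - ρc' + 8 * δ) / c + 1 + 1 / 3) * c = h - ρc' + 8 * δ + (4 / 3) * c := by
      rw [add_assoc, add_mul, h2]; ring
    rw [h4] at h3
    nlinarith

/-! ### Zone exclusion of interior vertices -/

/-- **Zone exclusion by clamping.**  If the closed `t`-disc about a point `u'` lies in `Ω`, the box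
`[Re p ± ρc] × [Im p - ρc', Im p]` misses `Ω`, and `|Re u' - Re p| < ρc + 10δ`,
`Im p - ρc' ≤ Im u' < Im p + ε` with `10δ + ε ≤ t`, we get a contradiction: the point of the box
nearest to `u'` (clamp the abscissa, cap the height at the floor) is within `10δ + ε` of `u'`. -/
theorem twoPiece_not_zone_of_closedBall_subset {Ω : Set ℂ} {p u' : ℂ} {ρc ρc' δ ε t : ℝ}
    (hB : ∀ z : ℂ, |z.re - p.re| ≤ ρc → p.im - ρc' ≤ z.im → z.im ≤ p.im → z ∉ Ω)
    (hball : closedBall u' t ⊆ Ω) (hρc : 0 ≤ ρc) (hρc' : 0 ≤ ρc') (hδ : 0 ≤ δ) (hε : 0 ≤ ε)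
    (hre : |u'.re - p.re| < ρc + 10 * δ) (hlo : p.im - ρc' ≤ u'.im) (hhi : u'.im < p.im + ε)
    (ht : 10 * δ + ε ≤ t) : False := by
  obtain ⟨hre1, hre2⟩ := abs_lt.1 hre
  -- the clamped abscissa
  set a : ℝ := max (p.re - ρc) (min u'.re (p.re + ρc)) with ha
  have ha1 : p.re - ρc ≤ a := le_max_left _ _
  have ha2 : a ≤ p.re + ρc := max_le (by linarith) (min_le_right _ _)
  have ha3 : |u'.re - a| ≤ 10 * δ := by
    rw [abs_le]
    constructor
    · -- `a ≤ u'.re + 10δ`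
      have : a ≤ max (p.re - ρc) u'.re := max_le_max le_rfl (min_le_left _ _)
      have h2 : max (p.re - ρc) u'.re ≤ u'.re + 10 * δ := max_le (by linarith) (by linarith)
      linarith
    · -- `u'.re - 10δ ≤ a`
      rcases le_total u'.re (p.re + ρc) with h1 | h1
      · have : min u'.re (p.re + ρc) = u'.re := min_eq_left h1
        have h2 : u'.re ≤ a := by rw [ha, this]; exact le_max_right _ _
        linarith
      · have : min u'.re (p.re + ρc) = p.re + ρc := min_eq_right h1
        have h2 : p.re + ρc ≤ a := by rw [ha, this]; exact le_max_right _ _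
        linarith
  -- the capped height
  set b : ℝ := min u'.im p.im with hb
  have hb1 : b ≤ p.im := min_le_right _ _
  have hb2 : p.im - ρc' ≤ b := le_min hlo (by linarith)
  have hb3' : |u'.im - b| ≤ ε := by
    rcases le_total u'.im p.im with h1 | h1
    · rw [hb, min_eq_left h1, sub_self, abs_zero]; exact hε
    · rw [hb, min_eq_right h1, abs_of_nonneg (by linarith)]; linarith
  -- the box point
  set x : ℂ := ⟨a, b⟩ with hx
  have hxΩ : x ∉ Ω := hB x (by rw [abs_le]; constructor <;> simp [hx] <;> linarith) (by simp [hx]; linarith)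
    (by simp [hx]; exact hb1)
  refine hxΩ (hball ?_)
  rw [mem_closedBall, dist_comm]
  refine (dist_le_abs_re_add_abs_im u' x).trans ?_
  simp only [hx, Complex.sub_re, Complex.sub_im]
  linarith [ha3, hb3']

/-- **Registered sub-goal `stub_carvedReduction_twoPieceFamilyCore`** (crux item
stmt-CriticalPhenomena-10472, stub T2b″ `stub_carvedReduction_squeezeSolid`, piece (G2-fam-d) ZONE
EXCLUSION OF INTERIOR VERTICES): registry form of `twoPiece_not_zone_of_closedBall_subset`. -/
theorem stub_carvedReduction_twoPieceFamilyCore :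
    ∀ (Ω : Set ℂ) (p u' : ℂ) (ρc ρc' δ ε t : ℝ),
      (∀ z : ℂ, |z.re - p.re| ≤ ρc → p.im - ρc' ≤ z.im → z.im ≤ p.im → z ∉ Ω) →
      closedBall u' t ⊆ Ω → 0 ≤ ρc → 0 ≤ ρc' → 0 ≤ δ → 0 ≤ ε → |u'.re - p.re| < ρc + 10 * δ →
      p.im - ρc' ≤ u'.im → u'.im < p.im + ε → 10 * δ + ε ≤ t → False :=
  fun _ _ _ _ _ _ _ _ hB hball hρc hρc' hδ hε hre hlo hhi ht =>
    twoPiece_not_zone_of_closedBall_subset hB hball hρc hρc' hδ hε hre hlo hhi ht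

/-! ### Clearly deep vertices are deep -/

/-- **Clearly deep vertices are deep.**  If the thresholds satisfy `row u < m i → Im(δ c_u) < Im(p i) + ρc'`
and rows `≥ mlo i` lie at height `> Im(p i) - ρc'`, then a vertex with `δ c_u ∈ Ω`, disc in
`Ω ∪ X`, and row `≥ m i` whenever `|ΔRe| < ρc + 10δ` and `|ΔIm| < ρc'`, lies in no zone, hence is
deep. -/
theorem twoPiece_deep_of_clearlyDeep {Ω X : Set ℂ} {p : Fin 2 → ℂ} {δ ρc ρc' r : ℝ}
    {m mlo : Fin 2 → ℤ}
    (hthr : ∀ i (u : HexVertex), u.1 1 < m i → ((δ : ℂ) * hexCenter u).im < (p i).im + ρc')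
    (hzone : ∀ i (u : HexVertex), mlo i ≤ u.1 1 → (p i).im - ρc' < ((δ : ℂ) * hexCenter u).im)
    {u : HexVertex} (huΩ : (δ : ℂ) * hexCenter u ∈ Ω)
    (hdisc : closedBall ((δ : ℂ) * hexCenter u) r ⊆ Ω ∪ X)
    (hrow : ∀ i, |((δ : ℂ) * hexCenter u).re - (p i).re| < ρc + 10 * δ →
      |((δ : ℂ) * hexCenter u).im - (p i).im| < ρc' → m i ≤ u.1 1) :
    (δ : ℂ) * hexCenter u ∈ Ω ∧
      (∀ i, ¬ (|((δ : ℂ) * hexCenter u).re - (p i).re| < ρc + 10 * δ ∧ mlo i ≤ u.1 1 ∧ u.1 1 < m i)) ∧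
      closedBall ((δ : ℂ) * hexCenter u) r ⊆ Ω ∪ X := by
  refine ⟨huΩ, fun i ⟨h1, h2, h3⟩ => ?_, hdisc⟩
  have h4 := hthr i u h3
  have h5 := hzone i u h2
  have h6 : |((δ : ℂ) * hexCenter u).im - (p i).im| < ρc' := by
    rw [abs_lt]; constructor <;> linarith
  exact (hrow i h1 h6).not_gt h3

end Summit.CriticalPhenomena.SAWScalingLimit.Theorems.ObservableToSLE.TypeLadder

end
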